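import Summits.QuantumFields.BalabanUV.Beta.EriceRemainderEnclosureHistoryAutonomyComparisonDualChainCriterion
import Summits.QuantumFields.BalabanUV.Beta.EriceRemainderEnclosureHistoryAutonomyComparisonTowerChainSix

/-!
# EriceRemainderEnclosureHistoryAutonomyComparisonTowerSix — (E65j) EVERY FINITE SET OF AGES WITH PAIRWISE RATIOS `≥ 6` COMPARES AT ANY SIZE, WHATEVER ITS
# CARDINALITY: `B(u) = b + Σ_{k<K} L_k·u_k` on ]0,γ] (`b > 0`, `L ≥ 0` supported on `{0} ∪ A`, `A ⊆ [1,K[` with `6·k ≤ k′` for `k < k′` in `A` — `#A`, the sizes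
# AND the Markov weight `L_0` ARBITRARY); `B′ ≥ B` with a zeroth moment and an ISOTONE excess ⟹ ANY box solutions from one pin satisfy `h′ ≤ h` at EVERY
# scale.  (E65f) with the chain of (E65i) (telescoped window weights); (E65h): `10`, (E64h): `14`

Cell `pub-balaban`, β-function sub-cell, BINDER row D4 «RemainderConst leaves for Bałaban's split» (`HOME/BINDER-OWNERS.md`; owner lineage `b2b-balaban-beta-an4`;
this file by co-owner #2 lineage `b2b-balaban-beta-d4-p2`, generation 58), β-FLOW TEAM duty (1), FREEZE (0) honoured (def-free; (E65f)'s
`le_of_isotone_excess_of_budgeted_dual_chain`, (E65i)'s `dual_chain_of_tower_six`, (E65b)'s `le_of_isotone_excess_budgeted_certificate` BY NAME; nothing restated).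

HONEST FRAMING (page 1, verbatim and binding).  *"Discharging BetaPertH makes Bałaban's UV stability UNCONDITIONAL — a real constructive-QFT result; it is
NOT the continuum limit and NOT the Clay problem."*  THIS FILE DISCHARGES NOTHING OF THE KIND.  Elementary real analysis about ABSTRACT affine functionals on a
box ]0,γ]^ℕ with displayed supports and signs — hypotheses of a census, not facts; the form, signs, ages and moments of Bałaban's (1.22) limit functional are
NOT PRINTED ([I] p. 298; GAPS G-t4-U2-1∕-2) and NOT asserted.  Row D4 class UNCHANGED (critical-path width 0; instance 0∕1; D4 DISCHARGE NO DATE).  HONEST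
DEPENDENCY: continuum YM on T⁴ ⇐ BetaPertH ∧ nine spine estimates (0/9 proved); BetaPertH ⇐ (D1) ∧ (D4) ∧ CAP+tail; G-an2-4 gates asym, D1 and NE2/3/4.

THE POINT (census sense (α); the COMPARISON column, conjecture (E58′)).  As (E65h), with (E65i)'s sharper reading of the window budget (the hypothesis of (E65i)
is the budget exactly as (E65f) offers it, so no reduction step is needed).  NOT CLAIMED: ratios below `6` (numerically free down to `2` — README); anything
printed.

WHAT IS PROVED ([folklore]; 0 `def`, 0 sorry).  **`le_of_isotone_excess_ages_ratio_six`** (END, Finset form).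
-/
noncomputable section
open Finset Set

namespace Summit.QuantumFields.BalabanUV.Beta.EriceRemainderEnclosureHistoryAutonomyComparisonTowerSix

open Literature.MathematicalPhysics.QuantumFieldTheory.Balaban1983to89
open Literature.MathematicalPhysics.QuantumFieldTheory.Balaban1983to89.T4BetaStationary
open Literature.MathematicalPhysics.QuantumFieldTheory.Balaban1983to89.T4BetaFlowWellPosed
open Summit.QuantumFields.BalabanUV.Beta.EriceRemainderEnclosureHistoryAutonomyComparisonBudgetedCriterion (le_of_isotone_excess_budgeted_certificate)
open Summit.QuantumFields.BalabanUV.Beta.EriceRemainderEnclosureHistoryAutonomyComparisonDualChainCriterion (le_of_isotone_excess_of_budgeted_dual_chain)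
open Summit.QuantumFields.BalabanUV.Beta.EriceRemainderEnclosureHistoryAutonomyComparisonTowerChainSix (dual_chain_of_tower_six)

variable {B' : (ℕ → ℝ) → ℝ} {M' γ b : ℝ} {L : ℕ → ℝ} {K : ℕ} {A : Finset ℕ} {h h' : ℕ → ℝ}

/-! ## END: towers of ratio `≥ 6`, any height, any sizes -/

/-- **EVERY FINITE SET OF AGES WITH PAIRWISE RATIOS `≥ 6` COMPARES AT ANY SIZE, WHATEVER ITS CARDINALITY.**  `B(u) = b + Σ_{k<K} L_k·u_k` on ]0,γ] with `b > 0`,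
`L ≥ 0` supported on `{0} ∪ A`, `A ⊆ [1, K[` with **`6·k ≤ k′` for `k < k′` in `A`** — `#A`, the sizes `L_k` AND the Markov weight `L_0` ARBITRARY; `B′` with
zeroth moment `M′ ≥ 0`, `B ≤ B′`, ISOTONE excess; `h`, `h′` ANY box solutions from one pin `p ∈ ]0,γ]`.  Then `h′ ≤ h` at EVERY scale ((E65f) with the chain of
(E65i); (E65h): `10`, (E64h): `14`). [folklore] -/
theorem le_of_isotone_excess_ages_ratio_six {p : ℝ} (hL : ∀ k, 0 ≤ L k) (hb : 0 < b) (hAK : A ⊆ range K) (hA1 : ∀ k ∈ A, 1 ≤ k)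
    (hsupp : ∀ k ∈ range K, k ∉ A → k ≠ 0 → L k = 0) (hsep : ∀ k ∈ A, ∀ k' ∈ A, k < k' → 6 * k ≤ k')
    (hB' : ∀ u u' : ℕ → ℝ, SeqBox γ u → SeqBox γ u' → ∀ D : ℝ, (∀ j, |u j - u' j| ≤ D) → |B' u - B' u'| ≤ M' * D) (hM' : 0 ≤ M')
    (hexc : ∀ u, SeqBox γ u → (fun u : ℕ → ℝ => b + ∑ k ∈ range K, L k * u k) u ≤ B' u)
    (hDmono : ∀ u v : ℕ → ℝ, SeqBox γ u → SeqBox γ v → (∀ j, u j ≤ v j) →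
      B' u - (fun u : ℕ → ℝ => b + ∑ k ∈ range K, L k * u k) u ≤ B' v - (fun u : ℕ → ℝ => b + ∑ k ∈ range K, L k * u k) v)
    (hp : 0 < p) (hpγ : p ≤ γ) (hh : SeqBox γ h) (hf : MemFlow (fun u : ℕ → ℝ => b + ∑ k ∈ range K, L k * u k) p h)
    (hh' : SeqBox γ h') (hf' : MemFlow B' p h') (j : ℕ) : h' j ≤ h j := by
  classical
  rcases A.eq_empty_or_nonempty with hA | hA
  · -- no age: the empty certificate
    subst hA
    exact le_of_isotone_excess_budgeted_certificate hL hb hAK hA1 hsupp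
      (fun x _ _ _ => ⟨fun _ => 0, fun _ h => absurd h (Finset.notMem_empty _), fun _ h => absurd h (Finset.notMem_empty _), by simp⟩)
      hB' hM' hexc hDmono hp hpγ hh hf hh' hf' j
  · -- the enumeration of A: minimum and predecessor map
    set m₀ := A.min' hA with hm₀_def
    have hm₀ : m₀ ∈ A := min'_mem A hA
    have hmin : ∀ k ∈ A, m₀ ≤ k := fun k hk => min'_le A k hk
    set pred : ℕ → ℕ := fun k => if hne : (A.filter (fun s => s < k)).Nonempty then (A.filter (fun s => s < k)).max' hne else 0
      with hpred_def
    have hpred : ∀ k ∈ A, k ≠ m₀ → pred k ∈ A ∧ pred k < k ∧ ∀ k'' ∈ A, k'' < k → k'' ≤ pred k := by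
      intro k hk hkm
      have hlt : m₀ < k := lt_of_le_of_ne (hmin k hk) (Ne.symm hkm)
      have hne : (A.filter (fun s => s < k)).Nonempty := ⟨m₀, mem_filter.mpr ⟨hm₀, hlt⟩⟩
      have hpk : pred k = (A.filter (fun s => s < k)).max' hne := by simp only [hpred_def, dif_pos hne]
      have hmem := max'_mem _ hne
      rw [← hpk] at hmem
      refine ⟨(mem_filter.mp hmem).1, (mem_filter.mp hmem).2, fun k'' hk'' hlt'' => ?_⟩
      rw [hpk]; exact le_max' _ _ (mem_filter.mpr ⟨hk'', hlt''⟩)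
    have hsix : ∀ k ∈ A, k ≠ m₀ → 6 * pred k ≤ k := fun k hk hkm => by
      obtain ⟨hpA, hplt, _⟩ := hpred k hk hkm
      exact hsep _ hpA _ hk hplt
    refine le_of_isotone_excess_of_budgeted_dual_chain hL hb hAK hA1 hsupp hm₀ hmin hpred (fun x hx _ hbud => ?_)
      hB' hM' hexc hDmono hp hpγ hh hf hh' hf' j
    exact dual_chain_of_tower_six hA1 hx hm₀ hmin hpred hsix (fun k hk => hbud k (hA1 k hk))

end Summit.QuantumFields.BalabanUV.Beta.EriceRemainderEnclosureHistoryAutonomyComparisonTowerSix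

end
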